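import Summits.AtomisticToContinuum.Crystallization.Theorems.OverbindingBudgetEnergyHeightsSeam
import Summits.AtomisticToContinuum.Crystallization.Theorems.OverbindingBudgetEnergyForceTail
import Summits.AtomisticToContinuum.Crystallization.Theorems.OverbindingBudgetEnergySpanBookkeeping

/-!
# OverbindingBudget · decomp-a2c lens-4 g35 — part XXIII-Y₂: the GAP CONTRACTION theorem (analytic core of GEO-OSC, PROVED)

Helper file under `--supports stmt-AtomisticToContinuum-31280` (RDEF = `Theses.OverbindingBudget.RobustDefectLimitWindows`); closes nothing.

GEO-OSC `…EnergyAffineStraightening.StackedHeightsOsc Λ₁ ω` (the last per-configuration leaf on the energy side of cone XXXVII) says that the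
gap heights of ONE admissible stacked configuration with zero transmitted gap stress lie in a band of width `≤ ω`.  This file proves the
configuration-level theorem behind it, with every analytic step discharged and the numerics isolated in per-gap / per-pair HYPOTHESES that a
finite force certificate supplies (part Z types the certificate and the geometric localisation and assembles `StackedHeightsOsc`):

★ `heights_band_of_force_rows` — fix an independent admissible cell (`‖a‖, ‖b‖ ≤ 17/16`, `δ ≥ 9/10`-separated layers, unit normal `n`), a stacked
offset profile `w` with ZERO GAP STRESS, a reference height `h⋆`, nonnegative deviation profiles `x m ≥ |⟪incr w m, n⟫ − h⋆|` (normal) and `u m`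
(lateral), a priori `≤ τX` resp. `≤ τU`, and certificate data: reference far normal forces `f s`, radii `ρ s`, height- and lateral-Lipschitz constants `c s`,
`c′ s` for the spans `2 ≤ s ≤ S`, and adjacent expansivity constants `(G_n, r_n)`, `(G_l, r_l)` with guard `Θ`.  IF
 (ADJ) at every gap, either `‖A_m + Φ•n‖ ≥ Θ` or `G_n·x m ≤ r_n + ‖A_m + Φ•n‖ ∧ G_l·u m ≤ r_l + ‖A_m + Φ•n‖`, where `A_m = layerForce a b (−incr w m)`
       is the adjacent layer force and `Φ = Σ_{2 ≤ s ≤ S} s·f s` the reference far load;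
 (FAR) every straddling pair `(k, l)` of span `2 ≤ s ≤ S` has `‖layerForce a b (w k − w l) − f s • n‖ ≤ ρ s + c s·Σ_{k<i≤l} x i + c′ s·Σ_{k<i≤l} u i`;
 (numbers) `Σ s·ρ s + 19/(h_lo⁵·3S³) ≤ R₁`, `Σ s²·c s ≤ C < G_n`, `Σ s²·c′ s ≤ C′ < G_l`, `C′C < (G_n − C)(G_l − C′)`, `R₁ + C·τX + C′·τU < Θ`,
       `(S+1)·h_lo ≥ 15/8` where `h_lo > 0` bounds the gap heights from below,
THEN every gap height lies within `ω₀ = ((G_l − C′)(r_n + R₁) + C′(r_l + R₁)) / ((G_n − C)(G_l − C′) − C′C)` of `h⋆`.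

Proof (all in this file): zero gap stress ⇒ `A_m = −farStress_m` (part V); the straddle sum splits EXACTLY into the `s` pairs of each span
`s ≤ S` (part Y₁ `…EnergySpanBookkeeping.sum_nearFin`: the parametrisation `pairOf` of part X is onto the pairs of span `≤ S`) plus a tail over spans `> S` bounded by the
far-force lemma of part W (`‖layerForce‖ ≤ 19·|P|⁻⁵` at height `|P| ≥ 15/8`) and `Σ_{s>S} s⁻⁴ ≤ 1/(3S³)` (part L); the reference terms sum to `Φ•n`;
so `‖A_m + Φ•n‖ ≤ R₁ + C·sup x + C′·sup u`, the guard `Θ` kills the first alternative of (ADJ), and the two-channel sup-norm contraction (part Y₁,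
an M-matrix inversion in dimension two) bounds `sup x`.  With `c′ = C′ = 0`, `G_l = 1` this is the scalar height contraction of part V.
-/

noncomputable section

namespace Summit.AtomisticToContinuum.Crystallization.Theorems.OverbindingBudgetEnergyGapContraction

open Finset
open scoped RealInnerProductSpace
open Summit.AtomisticToContinuum.Crystallization.Theorems.ChartedPlanarOrderChunkFloor (E3)
open Summit.AtomisticToContinuum.Crystallization.Theorems.ChartedPlanarOrderDensityDichotomy (IsSep)
open Summit.AtomisticToContinuum.Crystallization.Theorems.ChartedPlanarOrderDoorLayered (Layered)
open Summit.AtomisticToContinuum.Crystallization.Theorems.ChartedPlanarOrderProfileSlavingLJ (layerForce IsStacked gapStress incr)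
open Summit.AtomisticToContinuum.Crystallization.Theorems.ChartedPlanarOrderProfileSlavingLJBalance (pairFamily straddleSet)
open Summit.AtomisticToContinuum.Crystallization.Theorems.ChartedPlanarOrderStraddleSummable (summable_pairFamily_straddle)
open Summit.AtomisticToContinuum.Crystallization.Theorems.OverbindingBudgetRegistryCut (IsUnitNormal)
open Summit.AtomisticToContinuum.Crystallization.Theorems.OverbindingBudgetEnergyStraightening (le_norm_latticeVec_of_isSep)
open Summit.AtomisticToContinuum.Crystallization.Theorems.OverbindingBudgetEnergyHeightsSeam (adjPair farStress layerForce_neg_incr_eq)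
open Summit.AtomisticToContinuum.Crystallization.Theorems.OverbindingBudgetEnergyForceTail (norm_layerForce_far_of_cell)
open Summit.AtomisticToContinuum.Crystallization.Theorems.OverbindingBudgetEnergyStraddleCount (span norm_tsum_straddle_le)
open Summit.AtomisticToContinuum.Crystallization.Theorems.OverbindingBudgetEnergySpanBookkeeping (nearFin one_le_span span_cast
  mem_nearFin_iff sum_nearFin sum_Ioc_le_span_mul inner_span_eq_sum two_channel_contraction tailMaj tailMaj_nonneg tsum_tailMaj_le)

/-! ## ★ The band theorem -/

variable {a b n : E3} {w : ℤ → E3} {δ : ℝ}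

/-- ★★ **THE DEVIATION BANDS** (see the file header): both channels. -/
theorem deviation_bands_of_force_rows (hδ : 9 / 10 ≤ δ) (hab : LinearIndependent ℝ ![a, b]) (hst : IsStacked a b w)
    (hS : IsSep δ (Layered a b w)) (hn : IsUnitNormal a b n) (ha : ‖a‖ ≤ 17 / 16) (hb : ‖b‖ ≤ 17 / 16)
    (h0 : ∀ m : ℤ, gapStress a b m (incr w) = 0)
    {hlo Gn Gl C C' R₁ Θ τX τU rn rl : ℝ} {S : ℕ} {f ρ c c' : ℕ → ℝ} {x u : ℤ → ℝ}
    (hlo0 : 0 < hlo) (hband : ∀ m : ℤ, hlo ≤ ⟪incr w m, n⟫)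
    (hx : ∀ m, 0 ≤ x m ∧ x m ≤ τX) (hu : ∀ m, 0 ≤ u m ∧ u m ≤ τU)
    (hADJ : ∀ m : ℤ, Θ ≤ ‖layerForce a b (-incr w m) + (∑ s ∈ Icc 2 S, (s : ℝ) * f s) • n‖ ∨
      (Gn * x m ≤ rn + ‖layerForce a b (-incr w m) + (∑ s ∈ Icc 2 S, (s : ℝ) * f s) • n‖ ∧
        Gl * u m ≤ rl + ‖layerForce a b (-incr w m) + (∑ s ∈ Icc 2 S, (s : ℝ) * f s) • n‖))
    (hFAR : ∀ k l : ℤ, k < l → 2 ≤ span (k, l) → span (k, l) ≤ S →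
      ‖layerForce a b (w k - w l) - f (span (k, l)) • n‖ ≤
        ρ (span (k, l)) + c (span (k, l)) * ∑ i ∈ Ioc k l, x i + c' (span (k, l)) * ∑ i ∈ Ioc k l, u i)
    (hρ0 : ∀ s, 0 ≤ ρ s) (hc0 : ∀ s, 0 ≤ c s) (hc'0 : ∀ s, 0 ≤ c' s)
    (hR : ∑ s ∈ Icc 2 S, (s : ℝ) * ρ s + 19 / hlo ^ 5 * (3 * (S : ℝ) ^ 3)⁻¹ ≤ R₁)
    (hC : ∑ s ∈ Icc 2 S, (s : ℝ) ^ 2 * c s ≤ C) (hC' : ∑ s ∈ Icc 2 S, (s : ℝ) ^ 2 * c' s ≤ C')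
    (hΘ : R₁ + C * τX + C' * τU < Θ) (hp : C < Gn) (hq : C' < Gl) (hdet : C' * C < (Gn - C) * (Gl - C'))
    (hS1 : 1 ≤ S) (hSh : 15 / 8 ≤ ((S : ℝ) + 1) * hlo) :
    (∀ m : ℤ, x m ≤ ((Gl - C') * (rn + R₁) + C' * (rl + R₁)) / ((Gn - C) * (Gl - C') - C' * C)) ∧
      ∀ m : ℤ, u m ≤ ((Gn - C) * (rl + R₁) + C * (rn + R₁)) / ((Gn - C) * (Gl - C') - C' * C) := by
  classical
  have hδ0 : 0 < δ := by linarith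
  have hlat : ∀ i j : ℤ, ((i : ℝ) • a + (j : ℝ) • b) ≠ 0 → 9 / 10 ≤ ‖(i : ℝ) • a + (j : ℝ) • b‖ := fun i j hij =>
    hδ.trans (le_norm_latticeVec_of_isSep hS i j hij)
  set Φ : ℝ := ∑ s ∈ Icc 2 S, (s : ℝ) * f s with hΦ
  -- the sups
  set X := ⨆ m', x m' with hX
  set U := ⨆ m', u m' with hU
  have hbx : BddAbove (Set.range x) := ⟨τX, by rintro _ ⟨m, rfl⟩; exact (hx m).2⟩
  have hbu : BddAbove (Set.range u) := ⟨τU, by rintro _ ⟨m, rfl⟩; exact (hu m).2⟩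
  have hxX : ∀ i, x i ≤ X := fun i => le_ciSup hbx i
  have huU : ∀ i, u i ≤ U := fun i => le_ciSup hbu i
  have hX0 : 0 ≤ X := (hx 0).1.trans (hxX 0)
  have hU0 : 0 ≤ U := (hu 0).1.trans (huU 0)
  have hXτ : X ≤ τX := ciSup_le fun m => (hx m).2
  have hUτ : U ≤ τU := ciSup_le fun m => (hu m).2
  have hx' : ∀ m, 0 ≤ x m ∧ x m ≤ max τX τU := fun m => ⟨(hx m).1, (hx m).2.trans (le_max_left _ _)⟩
  have hu' : ∀ m, 0 ≤ u m ∧ u m ≤ max τX τU := fun m => ⟨(hu m).1, (hu m).2.trans (le_max_right _ _)⟩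
  have hCn : 0 ≤ C := le_trans (sum_nonneg fun s _ => mul_nonneg (by positivity) (hc0 s)) hC
  have hC'n : 0 ≤ C' := le_trans (sum_nonneg fun s _ => mul_nonneg (by positivity) (hc'0 s)) hC'
  -- ★ the key estimate at every gap: `‖A_m + Φ n‖ ≤ R₁ + C X + C' U`
  have key : ∀ m : ℤ, ‖layerForce a b (-incr w m) + Φ • n‖ ≤ R₁ + C * X + C' * U := by
    intro m
    -- (1) zero gap stress: adjacent force = − far stress
    have hA : layerForce a b (-incr w m) = -farStress a b w m := layerForce_neg_incr_eq hδ0 hab hst hS (h0 m)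
    -- (2) the far-stress family and its summability
    set Fm : straddleSet m → E3 := fun p => if p = adjPair m then 0 else layerForce a b (w (p : ℤ × ℤ).1 - w (p : ℤ × ℤ).2)
      with hFm
    have hfar : farStress a b w m = ∑' p, Fm p := rfl
    have hSm := summable_pairFamily_straddle hδ0 hab hst hS m
    have hFmS : Summable Fm := by
      have h1 := hSm.update (adjPair m) 0
      refine h1.congr fun p => ?_
      rw [Function.update_apply]
      by_cases hp : p = adjPair m
      · rw [if_pos hp, hFm]; simp only; rw [if_pos hp]
      · rw [if_neg hp, hFm]; simp only; rw [if_neg hp]; rfl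
    -- (3) the reference family (finitely supported) and the deviation family
    set f' : ℕ → ℝ := fun s => if 2 ≤ s then f s else 0 with hf'
    set ref : straddleSet m → E3 := fun p => if span (p : ℤ × ℤ) ≤ S then f' (span (p : ℤ × ℤ)) • n else 0 with href
    have hrefz : ∀ p ∉ nearFin m S, ref p = 0 := by
      intro p hp
      rw [mem_nearFin_iff] at hp
      rw [href]; simp only; rw [if_neg hp]
    have hrefS : Summable ref := summable_of_ne_finset_zero hrefz
    have hreft : ∑' p, ref p = Φ • n := by
      rw [tsum_eq_sum hrefz]
      have e1 : ∑ p ∈ nearFin m S, ref p = ∑ p ∈ nearFin m S, f' (span (p : ℤ × ℤ)) • n := by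
        refine sum_congr rfl fun p hp => ?_
        rw [mem_nearFin_iff] at hp
        rw [href]; simp only; rw [if_pos hp]
      rw [e1, sum_nearFin m S (fun s => f' s • n)]
      have e4 : ∑ s ∈ range (S + 1), s • (f' s • n) = (∑ s ∈ range (S + 1), (s : ℝ) * f' s) • n := by
        rw [sum_smul]; refine sum_congr rfl fun s _ => ?_; rw [mul_smul, Nat.cast_smul_eq_nsmul]
      rw [e4]
      congr 1
      rw [hΦ]
      have e2 : ∑ s ∈ range (S + 1), (s : ℝ) * f' s = ∑ s ∈ range (S + 1), if 2 ≤ s then (s : ℝ) * f s else 0 := by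
        refine sum_congr rfl fun s _ => ?_
        rw [hf']; simp only; split_ifs <;> simp
      have e3 : (Icc 2 S) = (range (S + 1)).filter (fun s => 2 ≤ s) := by
        ext s; simp only [mem_Icc, mem_filter, mem_range]; omega
      rw [e3, sum_filter, ← e2]
    set D : straddleSet m → E3 := fun p => Fm p - ref p with hDdef
    have hDS : Summable D := hFmS.sub hrefS
    have hsplit : farStress a b w m - Φ • n = ∑' p, D p := by
      rw [hfar, ← hreft, ← hFmS.tsum_sub hrefS]
    -- (4) termwise majorant `g(span)`
    set gN : ℕ → ℝ := fun s => if 2 ≤ s ∧ s ≤ S then ρ s + c s * ((s : ℝ) * X) + c' s * ((s : ℝ) * U) else 0 with hgN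
    set g : ℕ → ℝ := fun s => gN s + tailMaj hlo S s with hg
    have hgN0 : ∀ s, 0 ≤ gN s := by
      intro s; rw [hgN]; simp only; split_ifs
      · have := hρ0 s; have := hc0 s; have := hc'0 s; positivity
      · exact le_rfl
    have hg0 : ∀ s, 0 ≤ g s := fun s => add_nonneg (hgN0 s) (tailMaj_nonneg hlo0 S s)
    have hDg : ∀ p : straddleSet m, ‖D p‖ ≤ g (span (p : ℤ × ℤ)) := by
      intro p
      have hk : (p : ℤ × ℤ).1 < m ∧ m ≤ (p : ℤ × ℤ).2 := p.2
      have hs1 := one_le_span p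
      have hsc := span_cast (p : ℤ × ℤ) (by omega)
      set k := (p : ℤ × ℤ).1 with hkdef
      set l := (p : ℤ × ℤ).2 with hldef
      have hpkl : (p : ℤ × ℤ) = (k, l) := Prod.ext rfl rfl
      by_cases h1 : span (p : ℤ × ℤ) = 1
      · -- the adjacent pair: both families vanish
        have hpadj : p = adjPair m := by
          apply Subtype.ext
          show (p : ℤ × ℤ) = ((m - 1, m) : ℤ × ℤ)
          rw [hpkl]; rw [hpkl] at hsc; rw [h1] at hsc; push_cast at hsc
          ext <;> simp only <;> omega
        have hD0 : D p = 0 := by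
          rw [hDdef]; simp only; rw [hFm, href]; simp only
          rw [if_pos hpadj, if_pos (by omega), hf']; simp only; rw [if_neg (by omega), zero_smul, sub_zero]
        rw [hD0, norm_zero]; exact hg0 _
      · have hne : p ≠ adjPair m := by
          intro h; apply h1
          have : (p : ℤ × ℤ) = ((m - 1, m) : ℤ × ℤ) := congrArg Subtype.val h
          rw [this]; simp [span]
        have hFp : Fm p = layerForce a b (w k - w l) := by rw [hFm]; simp only; rw [if_neg hne]
        by_cases h2 : span (p : ℤ × ℤ) ≤ S
        · -- a certified span: the row
          have hs2 : 2 ≤ span (p : ℤ × ℤ) := by omega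
          have hrefp : ref p = f (span (p : ℤ × ℤ)) • n := by
            rw [href]; simp only; rw [if_pos h2, hf']; simp only; rw [if_pos hs2]
          have hrow := hFAR k l (by omega) (by rw [← hpkl]; exact hs2) (by rw [← hpkl]; exact h2)
          have hsx : ∑ i ∈ Ioc k l, x i ≤ (span (k, l) : ℝ) * X := sum_Ioc_le_span_mul hxX k l
          have hsu : ∑ i ∈ Ioc k l, u i ≤ (span (k, l) : ℝ) * U := sum_Ioc_le_span_mul huU k l
          have hgval : g (span (p : ℤ × ℤ)) = ρ (span (k, l)) + c (span (k, l)) * ((span (k, l) : ℝ) * X) +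
              c' (span (k, l)) * ((span (k, l) : ℝ) * U) := by
            rw [hg]; simp only; rw [hgN]; simp only; rw [if_pos ⟨hs2, h2⟩, tailMaj, if_neg (by omega), add_zero, hpkl]
          rw [hgval, hDdef]; simp only; rw [hFp, hrefp, hpkl]
          have i1 := mul_le_mul_of_nonneg_left hsx (hc0 (span (k, l)))
          have i2 := mul_le_mul_of_nonneg_left hsu (hc'0 (span (k, l)))
          linarith
        · -- the tail: part W
          push Not at h2
          have hrefp : ref p = 0 := by rw [href]; simp only; rw [if_neg (by omega)]
          have hgval : g (span (p : ℤ × ℤ)) = 19 * ((((span (p : ℤ × ℤ)) : ℝ) * hlo) ^ 5)⁻¹ := by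
            rw [hg]; simp only; rw [hgN]; simp only; rw [if_neg (by omega), tailMaj, if_pos h2, zero_add]
          -- height of the span offset
          have hsum : ⟪w l - w k, n⟫ = ∑ i ∈ Ioc k l, ⟪incr w i, n⟫ := inner_span_eq_sum w n (by omega)
          have hHge : ((span (k, l)) : ℝ) * hlo ≤ ⟪w l - w k, n⟫ := by
            rw [hsum]
            have hcard : ((Ioc k l).card : ℝ) = (span (k, l) : ℝ) := by rw [Int.card_Ioc]; simp [span]
            calc ((span (k, l)) : ℝ) * hlo = ∑ _i ∈ Ioc k l, hlo := by rw [sum_const, nsmul_eq_mul, hcard]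
              _ ≤ ∑ i ∈ Ioc k l, ⟪incr w i, n⟫ := sum_le_sum fun i _ => hband i
          have hspan_ge : ((S : ℝ) + 1) ≤ (span (k, l) : ℝ) := by
            have : S + 1 ≤ span (k, l) := by rw [← hpkl]; omega
            exact_mod_cast this
          have hH15 : 15 / 8 ≤ ⟪w l - w k, n⟫ := by
            have : ((S : ℝ) + 1) * hlo ≤ (span (k, l) : ℝ) * hlo := mul_le_mul_of_nonneg_right hspan_ge hlo0.le
            linarith
          have hP : ⟪w k - w l, n⟫ = -⟪w l - w k, n⟫ := by rw [← inner_neg_left, neg_sub]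
          have hPabs : |(-⟪w l - w k, n⟫)| = ⟪w l - w k, n⟫ := by rw [abs_neg, abs_of_pos (by linarith)]
          have hW := norm_layerForce_far_of_cell hab hn ha hb hlat hP (by rw [hPabs]; exact hH15)
          rw [hPabs] at hW
          rw [hgval, hDdef]; simp only; rw [hFp, hrefp, sub_zero, hpkl]
          have hpow : (((span (k, l)) : ℝ) * hlo) ^ 5 ≤ ⟪w l - w k, n⟫ ^ 5 :=
            pow_le_pow_left₀ (by positivity) hHge 5
          have hpos : 0 < (((span (k, l)) : ℝ) * hlo) ^ 5 := by
            have : (1 : ℝ) ≤ span (k, l) := by rw [← hpkl]; exact_mod_cast hs1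
            positivity
          calc ‖layerForce a b (w k - w l)‖ ≤ 19 * (⟪w l - w k, n⟫ ^ 5)⁻¹ := hW
            _ ≤ 19 * ((((span (k, l)) : ℝ) * hlo) ^ 5)⁻¹ := by gcongr
    -- (5) summability and value of `Σ s·g s`
    obtain ⟨hTs, hTle⟩ := tsum_tailMaj_le hlo0 hS1
    have hgNz : ∀ s ∉ Icc 2 S, (s : ℝ) * gN s = 0 := by
      intro s hs; rw [mem_Icc] at hs; rw [hgN]; simp only; rw [if_neg (by omega), mul_zero]
    have hgNS : Summable fun s : ℕ => (s : ℝ) * gN s := summable_of_ne_finset_zero hgNz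
    have hgNt : ∑' s : ℕ, (s : ℝ) * gN s ≤ ∑ s ∈ Icc 2 S, (s : ℝ) * ρ s + C * X + C' * U := by
      rw [tsum_eq_sum hgNz]
      have e : ∑ s ∈ Icc 2 S, (s : ℝ) * gN s =
          ∑ s ∈ Icc 2 S, (s : ℝ) * ρ s + (∑ s ∈ Icc 2 S, (s : ℝ) ^ 2 * c s) * X + (∑ s ∈ Icc 2 S, (s : ℝ) ^ 2 * c' s) * U := by
        rw [sum_mul, sum_mul, ← sum_add_distrib, ← sum_add_distrib]
        refine sum_congr rfl fun s hs => ?_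
        rw [mem_Icc] at hs
        rw [hgN]; simp only; rw [if_pos ⟨hs.1, hs.2⟩]; ring
      rw [e]
      have i1 := mul_le_mul_of_nonneg_right hC hX0
      have i2 := mul_le_mul_of_nonneg_right hC' hU0
      linarith
    have hgS : Summable fun s : ℕ => (s : ℝ) * g s := by
      have : (fun s : ℕ => (s : ℝ) * g s) = fun s : ℕ => (s : ℝ) * gN s + (s : ℝ) * tailMaj hlo S s := by
        funext s; rw [hg]; simp only; ring
      rw [this]; exact hgNS.add hTs
    have hgt : ∑' s : ℕ, (s : ℝ) * g s ≤ R₁ + C * X + C' * U := by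
      have : ∑' s : ℕ, (s : ℝ) * g s = ∑' s : ℕ, (s : ℝ) * gN s + ∑' s : ℕ, (s : ℝ) * tailMaj hlo S s := by
        rw [← hgNS.tsum_add hTs]; refine tsum_congr fun s => ?_; rw [hg]; simp only; ring
      rw [this]; linarith
    -- (6) conclude the key estimate
    obtain ⟨-, hnorm⟩ := norm_tsum_straddle_le m (F := D) hDg hg0 hgS
    rw [hA, show -farStress a b w m + Φ • n = -(farStress a b w m - Φ • n) by abel, norm_neg, hsplit]
    exact hnorm.trans hgt
  -- ★ the guard kills the first alternative; contraction
  have hrows : ∀ m : ℤ, Gn * x m ≤ (rn + R₁) + C * X + C' * U ∧ Gl * u m ≤ (rl + R₁) + C * X + C' * U := by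
    intro m
    have hk := key m
    have hlt : ‖layerForce a b (-incr w m) + Φ • n‖ < Θ := by
      have i1 : C * X ≤ C * τX := mul_le_mul_of_nonneg_left hXτ hCn
      have i2 : C' * U ≤ C' * τU := mul_le_mul_of_nonneg_left hUτ hC'n
      linarith
    rcases hADJ m with h | ⟨h1, h2⟩
    · exact absurd h (not_le.mpr hlt)
    · exact ⟨by linarith, by linarith⟩
  obtain ⟨hXle, hUle⟩ := two_channel_contraction hx' hu' hrows hCn hC'n hp hq hdet
  exact ⟨fun m => (hxX m).trans hXle, fun m => (huU m).trans hUle⟩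

/-- ★★ **THE BAND THEOREM**: with `x m ≥ |⟪incr w m, n⟫ − h⋆|`, every gap height lies within
`ω₀ = ((G_l − C′)(r_n + R₁) + C′(r_l + R₁))/((G_n − C)(G_l − C′) − C′C)` of `h⋆`. -/
theorem heights_band_of_force_rows (hδ : 9 / 10 ≤ δ) (hab : LinearIndependent ℝ ![a, b]) (hst : IsStacked a b w)
    (hS : IsSep δ (Layered a b w)) (hn : IsUnitNormal a b n) (ha : ‖a‖ ≤ 17 / 16) (hb : ‖b‖ ≤ 17 / 16)
    (h0 : ∀ m : ℤ, gapStress a b m (incr w) = 0)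
    {hlo hstar Gn Gl C C' R₁ Θ τX τU rn rl : ℝ} {S : ℕ} {f ρ c c' : ℕ → ℝ} {x u : ℤ → ℝ}
    (hlo0 : 0 < hlo) (hband : ∀ m : ℤ, hlo ≤ ⟪incr w m, n⟫)
    (hxP : ∀ m : ℤ, |⟪incr w m, n⟫ - hstar| ≤ x m) (hx : ∀ m, 0 ≤ x m ∧ x m ≤ τX) (hu : ∀ m, 0 ≤ u m ∧ u m ≤ τU)
    (hADJ : ∀ m : ℤ, Θ ≤ ‖layerForce a b (-incr w m) + (∑ s ∈ Icc 2 S, (s : ℝ) * f s) • n‖ ∨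
      (Gn * x m ≤ rn + ‖layerForce a b (-incr w m) + (∑ s ∈ Icc 2 S, (s : ℝ) * f s) • n‖ ∧
        Gl * u m ≤ rl + ‖layerForce a b (-incr w m) + (∑ s ∈ Icc 2 S, (s : ℝ) * f s) • n‖))
    (hFAR : ∀ k l : ℤ, k < l → 2 ≤ span (k, l) → span (k, l) ≤ S →
      ‖layerForce a b (w k - w l) - f (span (k, l)) • n‖ ≤
        ρ (span (k, l)) + c (span (k, l)) * ∑ i ∈ Ioc k l, x i + c' (span (k, l)) * ∑ i ∈ Ioc k l, u i)
    (hρ0 : ∀ s, 0 ≤ ρ s) (hc0 : ∀ s, 0 ≤ c s) (hc'0 : ∀ s, 0 ≤ c' s)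
    (hR : ∑ s ∈ Icc 2 S, (s : ℝ) * ρ s + 19 / hlo ^ 5 * (3 * (S : ℝ) ^ 3)⁻¹ ≤ R₁)
    (hC : ∑ s ∈ Icc 2 S, (s : ℝ) ^ 2 * c s ≤ C) (hC' : ∑ s ∈ Icc 2 S, (s : ℝ) ^ 2 * c' s ≤ C')
    (hΘ : R₁ + C * τX + C' * τU < Θ) (hp : C < Gn) (hq : C' < Gl) (hdet : C' * C < (Gn - C) * (Gl - C'))
    (hS1 : 1 ≤ S) (hSh : 15 / 8 ≤ ((S : ℝ) + 1) * hlo) (m : ℤ) :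
    |⟪incr w m, n⟫ - hstar| ≤ ((Gl - C') * (rn + R₁) + C' * (rl + R₁)) / ((Gn - C) * (Gl - C') - C' * C) :=
  (hxP m).trans ((deviation_bands_of_force_rows hδ hab hst hS hn ha hb h0 hlo0 hband hx hu hADJ hFAR hρ0 hc0 hc'0 hR hC hC' hΘ hp
    hq hdet hS1 hSh).1 m)

end Summit.AtomisticToContinuum.Crystallization.Theorems.OverbindingBudgetEnergyGapContraction

end
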